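import Mathlib
import HarnessLib
import HarnessLib.Audit
import Summits.RiemannHypothesis.Statement
import Literature.NumberTheory.LFunctions.WeilExplicit
import Literature.NumberTheory.LFunctions.ZetaZeros
import Summits.RiemannHypothesis.RiemannHypothesis.Theorems.WeilCombAssembly
import HarnessLib.Audit.Status.Attr

/-!
Route: WeilAdversary

DORMANT since 2026-08-29T21:03:25Z (census g0: costume (trib-confirmed census-trib-costume-B 2026-08-29; 21-frontier 19:16:23Z (b)); reversible --off) — unstaffed, not closed; items shared with open routes are served there. `ledger route dormant <id> --off` reactivates.

# Route WeilAdversary — the adversarial threshold of the Weil ladder: what zero counting plus a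
verified height can and cannot certify

**Thesis X (words).** Weil positivity on every truncated cone: `∀ a > 0, WeilPositivityOn a` —
Weil's quadratic functional `W(g ⋆ g̃)` has non-negative real part for every smooth `g` supported in
`[−a, a]`, for every `a` (the LADDER form; target item SHARED with route WeilPos,
stmt-RiemannHypothesis-0098; equal to `WeilPositivity` by the proved
`uniformWeilPositivity_iff_weilPositivity`). This route (card weil-ladder-adversary) works on the
SPECTRAL side of the ladder `a ↦ WeilPositivityOn a`. By the tree's `explicit_formula_holds`, `Re
Q(g) = Re Σ_ρ k̂(ρ)` with `k̂ = weilMellin (weilConv g (weilReflect g))`, and for `ρ = 1/2 + y +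
ix`, `k̂(ρ) = Φ(x − iy)·conj Φ(x + iy)`, `Φ(z) = ∫ g(t) e^{izt} dt` entire of exponential type `a`.
Plancherel gives `∫ Re k̂ dx = 2π‖g‖²` for EVERY displacement `y`: off-line zeros are invisible to
leading order, so what ZERO COUNTING (explicit Riemann–von Mangoldt band) plus RH VERIFIED TO HEIGHT
T₀ can certify is a well-posed extremal problem in Paley–Wiener sampling theory.

**Posited object (inline in every item; definition request filed).** ADVERSARIAL WEIL POSITIVITY
`AdvPos(a; T₀; c₁, c₂, c₀)`: for every enumeration `ρ : ℕ → ℂ` (repetition = multiplicity) with `0 <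
Re ρₙ < 1`, `0 < Im ρₙ`, `Im ρₙ ≤ T₀ → Re ρₙ = 1/2`, `{n | Im ρₙ ≤ T}` finite for all `T`, and `|#{n
| Im ρₙ ≤ T} − (T/2π) log(T/2πe)| ≤ c₁ log T + c₂ log log T + c₀` for `T ≥ T₀`, and every Weil test
`g` with `tsupport g ⊆ [−a, a]`: `0 ≤ Re Σ'ₙ [k̂(ρₙ) + k̂(conj ρₙ)]`. It is antitone in `a`; the
true zeros are one admissible configuration (support item AdversaryTransfer: `RiemannHypothesisUpTo
T₀ → band → AdvPos a … → WeilPositivityOn a`, provable from the tree).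

**X (Lean).** `∀ a : ℝ, 0 < a → Literature.NumberTheory.LFunctions.WeilPositivityOn a`; every item
elaborates (Sketch.lean rc 0; constants `weilMellin`, `weilConv`, `weilReflect`, `IsWeilTest`,
`WeilPositivityOn`, `zetaZeroCount`,
`Literature.NumberTheory.DiophantineGeometry.RiemannHypothesisUpTo`, `Summit.RiemannHypothesis`
verified with `lean search`).

**Assembly.** `(∀ a : ℝ, 0 < a → WeilPositivityOn a) → Summit.RiemannHypothesis` (shared with
WeilPos, stmt-RiemannHypothesis-0099) is
`Literature.NumberTheory.LFunctions.riemannHypothesis_iff_forall_weilPositivityOn.mpr` (PROVED in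
tree: weil_criterion_holds + uniformWeilPositivity_iff_weilPositivity; one line, checked in
SketchRestate.lean). Inside the route: AdvPos at a rung + AdversaryTransfer + a counting band + a
verified height ⇒ that rung of WeilPos; the rungs above the adversarial threshold are exactly where
arithmetic beyond counting is needed (the honest RH-strength residue, NOT filed as a separate item —
it is the shared target).

Rationale: WHY THIS LINE (card RiemannHypothesis/RiemannHypothesis/weil-ladder-adversary; imports:
sampling/frame theory in Paley–Wiener spaces — Plancherel–Pólya, Duffin–Schaeffer, Beurling–Landau
densities, Ortega-Cerdà–Seip arXiv:math/0005092 — against the tree's explicit zero counting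
abs_zetaZeroCount_sub_main_le_explicit (|N−M| ≤ 0.3083 log T + 4.128, PROVED) /
HasanalizadeShenWong2022 (fact zetaZeroCount_hasanalizade_shen_wong) and the verified height
PlattTrudgianBLMS2021 (fact platt_trudgian_numerical_rh)). Route WeilPos files the prime-2 rung
WeilPositivityOn (log 3/2) as its crux #2 with no engine; Bombieri2000 §13 saw numerically that a
fictitious off-line zero is invisible to the truncated Weil form below a critical support. This
route makes that threshold a typed, two-sided object: AdvPos(a; T₀; band) is either a theorem of
sampling theory (then, via AdversaryTransfer, the rung follows from counting + verification ALONE)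
or is refuted by an explicit configuration (then the rung provably needs arithmetic beyond counting
— LindelofBacklund quantified for Weil positivity).
PLANNER'S ESTIMATE (NOTES.md §threshold; drives the ranking). Test Φ = Ψ_ε(x−T)·sin(a(x−T)) gives Re
k̂/A² = (1 − cosh(2ay)cos(2a(x−T)))/2; an adversary with band E and density D = log(T/2π)/2π piles
2E points at each node (depth y → 1/2), empties a stretch ℓ* = 2E/D = 4πE/log(T/2π) at each
antinode, density D elsewhere; per period the sum is ∝ π − cosh(a)(aℓ* + sin(aℓ*)). ATTACK WINS iff
cosh(a)(aℓ* + sin aℓ*) > π. At T₀ = 3.0·10¹² with the PROVED band: E = 12.99, D = 4.28, ℓ* = 6.07 ⇒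
threshold a ≈ 0.346 ≈ (log 2)/2 = 0.3466 (coincidence with the archimedean rung); a = 0.4 wins
(needs ℓ* ≥ 5.0); at a = 0.549 the period π/a = 5.72 < ℓ* so piling every zero at a node wins
outright; a = 1/4 needs ℓ* ≥ 9.2 vs 6.07 available (34% short). HSW band at 3·10¹²: E ≈ 13.1, same.
Asymptotically ℓ* → 4πc₁: 3.87 (slope 0.3083: rung 2 NEVER certifiable) or 1.30 (slope 0.1038): rung
2 (needs ℓ* < 3.17) enters at T ≈ 2·10³² and has 27% margin at 10⁶⁰ (ℓ* = 2.30). So the card's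
numbers are corrected: a* today ≈ 0.34, not 1.7–1.9; the cost law is real and brutal (additive
constants of Backlund–Jensen S(T) bounds, C₃' = 8.37 in HSW Thm 1.3 even for T ≥ 3·10¹⁰, are the
bottleneck, not the verified height).
RANKED CRUXES.
- #2 SamplingRungTwo: AdvPos(log 3/2; 10⁶⁰; 0.1038, 0.2573, 9.3675). Two-sided and decisive: PROVED
⇒ (HSW fact) → RiemannHypothesisUpTo 10⁶⁰ → WeilPositivityOn (log 3/2), i.e. the prime-2 rung has a
FINITE verification price (cost law as a theorem); REFUTED at every height ⇒ rung 2 is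
counting-inaccessible in principle with Backlund-type S(T) slopes.
- #3 SamplingEngine: AdvPos(1/4; 3 000 175 332 800; 0.3083, 0, 4.128): the positive sampling theorem
with inputs PROVED in tree (Platt–Trudgian enters only through the transfer). Conclusion known (a ≤
0.3466 geometrically) — value = the engine with explicit frame constants, the card's claim (1) made
exact.
- #4 CountingNoGo: ¬AdvPos(2/5; same T₀, same band): explicit pile-and-stretch configuration; ⇒
(antitone) no-go at rung 2: today's counting + verification cannot certify any support in [0.4, ∞).
Support: AdversaryTransfer (provable now: explicit_formula_holds, hasWeilZeroSide_tsum, enumeration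
of zeros with multiplicity, RiemannHypothesisUpTo); target/assembly shared with WeilPos
(stmt-0098/0099).
KILL CRITERIA. (i) #3 refuted at a = 1/4 AND at a = 1/8: the sampling engine certifies nothing —
close `refuted`, keep #4 as a Literature/Barriers entry. (ii) #2 refuted together with a proof that
inf over admissible configurations is < 0 for every T₀ at a = log 3/2 (ℓ*-floor 4π·0.1038): close as
`exhausted` with census "rung 2 needs arithmetic beyond counting at any verification height"; the
no-go migrates to Literature/Barriers/RiemannHypothesis. (iii) AdversaryTransfer unprovable because
the inline AdvPos mis-models the zero side (summability/junk): restate all items with the corrected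
block (one edit).
NOT DECOMPOSED YET. No frozen-height model item (fixed D, E on ℝ — the prover's first `--supports`
lemma), no kit job for the optimal attack (recommended first refuter move: LP over configurations ×
finite PW_a basis at D = 4.28, E = 13 and at D = 21.7, E = 25.0), no Beurling-realisability item
(card item 5), no S(T)-improvement item (an explicit |S(T)| ≤ 0.1038 log T + c with c ≲ 1 above
3·10¹² would move rung 2 to T₀ = Platt–Trudgian; 8× below HSW's C₃'), no displacement–discrepancy
re-typing of the target (it restates X).

Novelty: NOVELTY (searched 2026-08-15 before claiming; services partly degraded: searchd/galaxy rc 75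
intermittently, OpenAlex 429). lit search --source zbmath "Weil explicit formula positivity" (24
rows: Connes 1999/2000, Bombieri–Lagarias 1999, Burnol 2000, Bombieri 2003 doi:10.1002/cpa.10089,
Miller 2002 arXiv:math/0112196, X.-J. Li 2004/2012/2023, Goldfeld 1994 — positivity USED with chosen
band-limited tests or studied variationally; none quantifies what counting data alone certifies);
"argument of the Riemann zeta function explicit bound S(T)" (8 rows: Trudgian 2014 arXiv:1208.5846,
Carneiro–Chandee–Milinovich 2013/2015, Simonič 2022 arXiv:2010.13307 (under RH), HSW via tree file
ZetaZeroCountExplicit.lean: C₃' = 8.37 for T ≥ 3·10¹⁰); "Paley-Wiener sampling density zeros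
explicit formula positivity" (0); "Weil quadratic functional off-line zero negative eigenvalue
support" (0); lit frontier RiemannHypothesis --since 2020 (Connes arXiv:2602.04022, D_log spectra
arXiv:2601.12133, level analog of Selberg's S(t) result 2026 — none adversarial); lit bridges
(generic). Inherits the card's audit (refuter-novelty-audit-2-0, new-combination): nearest prior art
Bombieri2000 §13 (READ by refuter: fictitious zero 0.52+3.14i, critical support t_c, numerically)
and Thms 10–11; Voros/Oesterlé cost laws for Li's criterion; Suzuki 2023 doi:10.1112/jlms.12785 §4;
Yoshida1992 (geometric-side rungs, acq-00160 paywalled).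
DELTA: (a) the counting-only adversary as a TYPED two-sided object AdvPos(a; T  [refs: 10.1002/cpa.10089, 10.1112/jlms.12785, math/0112196, 1208.5846, 2010.13307, 2602.04022, 2601.12133, doi:10.1002/cpa.10089, doi:10.1112/jlms.12785, Bombieri2000, Yoshida1992]

Barriers (technique_class: Weil-positivity Paley-Wiener-sampling adversarial-threshold): BARRIERS (technique_class: Weil-positivity Paley-Wiener-sampling adversarial-threshold; catalogue
Literature/Barriers/RiemannHypothesis, 30 entries listed, read: LindelofBacklund,
BeurlingCounterexamples (DiamondMontgomeryVorhauer2006_thm1), ScalingSystemCounting,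
DeBrangesPositivity, NewmanConjecture, GramRosserFailures).
- Literature.Barriers.RiemannHypothesis.LindelofBacklund (Titchmarsh Thm 13.5: counting/size
information yields density statements, not RH): APPLIES and is the CONTENT of the route — crux #4
(CountingNoGo) is this barrier made quantitative for Weil positivity (support ≥ 0.4 is not
certifiable from the proved counting band + Platt–Trudgian), crux #2 locates where a finite
verification height overcomes it for rung 2; the route never claims RH from counting: above the
adversarial threshold the target is the shared RH-strength X.
- Literature.Barriers.RiemannHypothesis.DiamondMontgomeryVorhauer2006_thm1 /
BrouckeDebruyneRevesz2023 (Beurling systems with off-line zeros and regular counting): not engaged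
by the positive items (no Landau-method inference about ℤ is drawn); a RESOURCE for the negative
side — a Beurling zeta realising an AdvPos-violating configuration would show which rungs are
'generic' (card item 5, deliberately not filed).
- Literature.Barriers.RiemannHypothesis.ScalingSystemCounting (N(T) obeys no power law): not engaged
— the adversary is given the true (T/2π)log(T/2πe) main term with an explicit band.
- Literature.Barriers.RiemannHypothesis.De

History (route lifecycle, newest last):
- 2026-08-15T10:53:56Z · rev 1: restated AdversaryThesis (stmt-RiemannHypothesis-1161), Assembly (stmt-RiemannHypothesis-1166) — align target/assembly with WeilPos's ladder form (stmt-0098/0099 were restated to ∀ a > 0, WeilPositivityOn a at 10:52Z while this route was being opened) so th (planner-plancard-RiemannHypothesis-RiemannHyp-2dc87805-0)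
- 2026-08-15T16:55:38Z · rev 5: restated AdversaryTransfer (stmt-RiemannHypothesis-1165) — route-repair (rbadge g2, glue+cone): (1) DECIDING THEOREM supplied — `closes : AdversaryThesis → SamplingRungTwo → SamplingEngine → CountingNoGo → AdversaryTran (planner-rbadge-RiemannHypothesis-WeilAdversary-e27d1058-g2-0)
- 2026-08-16T04:16:42Z · AUTO-CRUX (backfill): AdversaryThesis — hypotheses of the deciding theorem that nothing in the route derives are cruxes (operator:999:1085951)
- 2026-08-29T21:03:25Z · DORMANT — census g0: costume (trib-confirmed census-trib-costume-B 2026-08-29; 21-frontier 19:16:23Z (b)); reversible --off (operator:999:1802202)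

sub-problem: RiemannHypothesis · status: dormant · opened planner-plancard-RiemannHypothesis-RiemannHyp-2dc87805-0 2026-08-15T10:52:58Z · rev 5 · ledger route-RiemannHypothesis-WeilAdversary
GENERATED by the gate from the ledger (D-0016/17). Provers cite these decls: `theorem foo : Summit.RiemannHypothesis.RiemannHypothesis.Theses.WeilAdversary.<Decl> := …` in Summits/RiemannHypothesis/RiemannHypothesis/Theorems/<Name>.lean.
-/

namespace Summit.RiemannHypothesis.RiemannHypothesis.Theses.WeilAdversary

open scoped BigOperators Topology Manifold Classical MeasureTheory ProbabilityTheory Matrix InnerProductSpace ComplexConjugate ContinuousMap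
open Filter Set Function TopologicalSpace MeasureTheory

attribute [summit_statement] _root_.Summit.RiemannHypothesis

open Summit

-- earlier AdversaryThesis (stmt-RiemannHypothesis-1161, replaced 2026-08-15T10:53:56Z -> stmt-RiemannHypothesis-0098): retired by None — Literature.NumberTheory.LFunctions.WeilPositivity
/-- item stmt-RiemannHypothesis-0098 · crux (kind.auto-crux: conjecture-grade) · rank 0 · open · by planner
why it might fail: X = ∀ a>0, WeilPositivityOn a ↔ RH (riemannHypothesis_iff_forall_weilPositivityOn, proved): false iff an off-line zero exists; no margin at X (NewmanConjecture); no conjunction of this route's cruxes reaches X — by CountingNoGo, counting + Platt–Trudgian certify nothing at support ≥ 0.4.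
sources: Literature.NumberTheory.LFunctions.riemannHypothesis_iff_forall_weilPositivityOn, Literature.NumberTheory.LFunctions.weil_criterion_holds, Bombieri2000 Thm 1-2 and §4, arXiv:2106.01715 §2.5, Literature.Barriers.RiemannHypothesis.NewmanConjecture, card:RiemannHypothesis/RiemannHypothesis/weil-ladder-adversary
Thesis X of route WeilPos: Weil's quadratic functional weilQuadratic g = W(g ⋆ g̃) has non-negative
real part for every smooth compactly supported g : ℝ → ℂ (additive normalisation of Literature
WeilExplicit). Equivalent to RH by Weil's criterion [Weil1952; Bombieri2000 Thm 1; Yoshida1992].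
Equals ∀ a > 0, WeilPositivityOn a (uniformWeilPositivity_iff_weilPositivity, proved in Literature). -/
@[route_item "route-RiemannHypothesis-WeilAdversary", crux]
def AdversaryThesis : Prop :=
  ∀ a : ℝ, 0 < a → Literature.NumberTheory.LFunctions.WeilPositivityOn a

/-- item stmt-RiemannHypothesis-1162 · crux · rank 2 · open · by planner
why it might fail: T₀=1e60 fixed: ℓ*=2.30 is shown repelled only for sine-type tests (monotone crit 3.16; two-sided-band crit 2.52, 9.6% slack). AdvPos ranges over ALL type-0.549 tests and general Bernstein/off-line constants lose far more (κ=1 ⇒ a<1/ℓ*=0.434): an extremal non-sine test or lossy frame bounds sink it.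
sources: HasanalizadeShenWong2022 Cor 1.2 (tree fact Literature.NumberTheory.LFunctions.zetaZeroCount_hasanalizade_shen_wong; constants 0.1038/0.2573/9.3675, T ≥ e — match the item), Vaaler1985 Thm 11 + Cor 12 (Beurling–Selberg one-sided L¹ approximation of BV functions by type-2πδ entire functions: the toolkit for the monotone-N extremal problem; doi:10.1090/S0273-0979-1985-15349-2, read pp.17–20), DonohoLogan1992 (large-sieve concentration of PW functions on sparse sets: bounds what piles can extract), DuffinSchaeffer1952; arXiv:math/0005092 (frames / sampling densities in PW spaces), Bombieri2000 §13 (numerical critical support for a fictitious off-line zero), Literature.NumberTheory.DiophantineGeometry.RiemannHypothesisUpTo (the payoff hypothesis at 1e60)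
SAMPLING POSITIVITY AT THE PRIME-2 RUNG FROM A FINITE HEIGHT (crux #2): AdvPos(a = (log 3)/2; T₀ =
10⁶⁰; band 0.1038 log T + 0.2573 log log T + 9.3675 = Hasanalizade–Shen–Wong Cor 1.2, the tree's
named fact zetaZeroCount_hasanalizade_shen_wong). ADVERSARIAL WEIL POSITIVITY AdvPos(a; T₀;
c₁,c₂,c₀) (inline): for every enumeration ρ : ℕ → ℂ (repeats = multiplicity) of points with 0 < Re
ρₙ < 1, 0 < Im ρₙ, Re ρₙ = 1/2 whenever Im ρₙ ≤ T₀, {n | Im ρₙ ≤ T} finite for every T, and counting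
band |#{n | Im ρₙ ≤ T} − (T/2π)log(T/2πe)| ≤ c₁ log T + c₂ log log T + c₀ for T ≥ T₀, and every Weil
test g with tsupport g ⊆ [−a,a]: 0 ≤ Re Σ'ₙ [k̂(ρₙ) + k̂(conj ρₙ)], k̂ = weilMellin (weilConv g
(weilReflect g)) (= ĝ(s)·conj ĝ(1−s̄); for ρ = 1/2+y+ix this is Φ(x−iy)·conj Φ(x+iy), Φ(z) = ∫ g
e^{izt}, and ∫ Re k̂ dx = 2π‖g‖² for every y). Conjugate (lower half-plane) points are added inside
the sum; the ρ ↦ 1−ρ̄ symmetry is deliberately NOT imposed (it only pairs equal values of Re k̂).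
Junk-safe: for admissible ρ the series converges absolutely (N(T) ≪ T log T, |k̂(s)| ≪_g (1+|Im
s|)⁻⁴ on the strip), and a refutation must exhibit actual summability with a negative sum. MEANING:
with AdversaryTransfer a -/
@[route_item "route-RiemannHypothesis-WeilAdversary", crux]
def SamplingRungTwo : Prop :=
  ∀ ρ : ℕ → ℂ, (∀ n, 0 < (ρ n).re ∧ (ρ n).re < 1 ∧ 0 < (ρ n).im) → (∀ n, (ρ n).im ≤ (10 : ℝ) ^ 60 → (ρ n).re = 1 / 2) → (∀ T : ℝ, {n | (ρ n).im ≤ T}.Finite) → (∀ T : ℝ, (10 : ℝ) ^ 60 ≤ T → |({n | (ρ n).im ≤ T}.ncard : ℝ) - T / (2 * Real.pi) * Real.log (T / (2 * Real.pi * Real.exp 1))| ≤ 0.1038 * Real.log T + 0.2573 * Real.log (Real.log T) + 9.3675) → ∀ g : ℝ → ℂ, Literature.NumberTheory.LFunctions.IsWeilTest g → tsupport g ⊆ Set.Icc (-(Real.log 3 / 2)) (Real.log 3 / 2) → 0 ≤ (∑' n, (Literature.NumberTheory.LFunctions.weilMellin (Literature.NumberTheory.LFunctions.weilConv g (Literature.NumberTheory.LFunctions.weilReflect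 g)) (ρ n) + Literature.NumberTheory.LFunctions.weilMellin (Literature.NumberTheory.LFunctions.weilConv g (Literature.NumberTheory.LFunctions.weilReflect g)) (starRingEnd ℂ (ρ n)))).re

/-- item stmt-RiemannHypothesis-1163 · crux · rank 3 · open · by planner
why it might fail: a=1/4 is <1% inside the sine's two-sided-band threshold (a_bb=0.252: ℓ_bb(1/4)=6.12 vs ℓ*=6.07): no IBP/Bernstein proof with any constant loss works, so monotone N must be exploited (one-sided Beurling–Selberg problem, open over all type-1/4 tests); truth leans on the sine being near-extremal.
sources: Literature.NumberTheory.LFunctions.abs_zetaZeroCount_sub_main_le_explicit (PROVED, T ≥ 30: E=0.3083 log T+4.128=12.985, D=4.280, ℓ*=6.068 at T₀), PlattTrudgianBLMS2021 Thm 1 (tree fact platt_trudgian_numerical_rh ↔ riemannHypothesisUpTo_platt_trudgian; enters only via AdversaryTransfer), Literature.NumberTheory.LFunctions.weilPositivityOn_of_le_log_two_half (the CONSEQUENCE WeilPositivityOn(1/4) is known — Yoshida; AdvPos(1/4) itself is not in print), Vaaler1985 Thm 11 + Cor 12 (one-sided Beurling–Selberg majorants/minorants of BV functions, ∫(M−f)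 ≤ V_f/2δ: the monotone extremal toolkit), DonohoLogan1992 (large-sieve concentration bounds for PW functions on sets of bounded density), DuffinSchaeffer1952; arXiv:math/0005092 (frame/sampling constants)
THE SAMPLING ENGINE AT SUPPORT 1/4 WITH PROVED INPUTS (crux #3): AdvPos(a = 1/4; T₀ = 3 000 175 332
800 = Platt–Trudgian height; band 0.3083 log T + 4.128 = the tree's THEOREM
abs_zetaZeroCount_sub_main_le_explicit (T ≥ 30), written with c₂ = 0). ADVERSARIAL WEIL POSITIVITY
AdvPos(a; T₀; c₁,c₂,c₀) (inline): for every enumeration ρ : ℕ → ℂ (repeats = multiplicity) of points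
with 0 < Re ρₙ < 1, 0 < Im ρₙ, Re ρₙ = 1/2 whenever Im ρₙ ≤ T₀, {n | Im ρₙ ≤ T} finite for every T,
and counting band |#{n | Im ρₙ ≤ T} − (T/2π)log(T/2πe)| ≤ c₁ log T + c₂ log log T + c₀ for T ≥ T₀,
and every Weil test g with tsupport g ⊆ [−a,a]: 0 ≤ Re Σ'ₙ [k̂(ρₙ) + k̂(conj ρₙ)], k̂ = weilMellin
(weilConv g (weilReflect g)) (= ĝ(s)·conj ĝ(1−s̄); for ρ = 1/2+y+ix this is Φ(x−iy)·conj Φ(x+iy),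
Φ(z) = ∫ g e^{izt}, and ∫ Re k̂ dx = 2π‖g‖² for every y). Conjugate (lower half-plane) points are
added inside the sum; the ρ ↦ 1−ρ̄ symmetry is deliberately NOT imposed (it only pairs equal values
of Re k̂). Junk-safe: for admissible ρ the series converges absolutely (N(T) ≪ T log T, |k̂(s)| ≪_g
(1+|Im s|)⁻⁴ on the strip), and a refutation must exhibit actual summability with a negative sum.
MEANING: a theorem of Paley–Wien -/
@[route_item "route-RiemannHypothesis-WeilAdversary", crux]
def SamplingEngine : Prop :=
  ∀ ρ : ℕ → ℂ, (∀ n, 0 < (ρ n).re ∧ (ρ n).re < 1 ∧ 0 < (ρ n).im) → (∀ n, (ρ n).im ≤ 3000175332800 → (ρ n).re = 1 / 2) → (∀ T : ℝ, {n | (ρ n).im ≤ T}.Finite) → (∀ T : ℝ, 3000175332800 ≤ T → |({n | (ρ n).im ≤ T}.ncard : ℝ) - T / (2 * Real.pi) * Real.log (T / (2 * Real.pi * Real.exp 1))| ≤ 0.3083 * Real.log T + 0 * Real.log (Real.log T) + 4.128) → ∀ g : ℝ → ℂ, Literature.NumberTheory.LFunctions.IsWeilTest g → tsupport g ⊆ Set.Icc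 (-(1 / 4 : ℝ)) (1 / 4) → 0 ≤ (∑' n, (Literature.NumberTheory.LFunctions.weilMellin (Literature.NumberTheory.LFunctions.weilConv g (Literature.NumberTheory.LFunctions.weilReflect g)) (ρ n) + Literature.NumberTheory.LFunctions.weilMellin (Literature.NumberTheory.LFunctions.weilConv g (Literature.NumberTheory.LFunctions.weilReflect g)) (starRingEnd ℂ (ρ n)))).re

/-- item stmt-RiemannHypothesis-1164 · crux · rank 4 · open · by planner
why it might fail: Thin margin: the monotone sine attack (optimal vs the sine) gives −6.1% of mean at a=2/5 ideally, −4.9% with 25-point piles and y=0.49, −3.9…−4.4% after the type-ε envelope (a'=0.39–0.395); the T₀-boundary pile, ℓ*(T) drift (5.90 at 10T₀) and rigorous tails of the infinite tsum could eat the rest.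
sources: Literature.NumberTheory.LFunctions.abs_zetaZeroCount_sub_main_le_explicit (the band the witness must respect exactly, T ≥ 30), PlattTrudgianBLMS2021 Thm 1 (T₀ = 3 000 175 332 800), Literature.Barriers.RiemannHypothesis.LindelofBacklund (the barrier this item quantifies), Bombieri2000 §13 and Thms 10–11 (off-line zeros vs negative eigenvalues of the truncated form), HasanalizadeShenWong2022 Thm 1.3 (C₃'=8.37 for T ≥ 3·10¹⁰: why the band cannot be shrunk today), gen-2 retriage recomputation (NOTES.md §Session log: thresholds 0.3459/0.3559/0.3577; a=0.40: −6.07%/−4.89%; a'=0.39: −5.12%/−3.86%; a'=0.395: −5.60%/−4.38%)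
COUNTING NO-GO AT SUPPORT 2/5 (crux #4, negative side): ¬AdvPos(a = 2/5; T₀ = 3 000 175 332 800;
band 0.3083 log T + 4.128). ADVERSARIAL WEIL POSITIVITY AdvPos(a; T₀; c₁,c₂,c₀) (inline): for every
enumeration ρ : ℕ → ℂ (repeats = multiplicity) of points with 0 < Re ρₙ < 1, 0 < Im ρₙ, Re ρₙ = 1/2
whenever Im ρₙ ≤ T₀, {n | Im ρₙ ≤ T} finite for every T, and counting band |#{n | Im ρₙ ≤ T} −
(T/2π)log(T/2πe)| ≤ c₁ log T + c₂ log log T + c₀ for T ≥ T₀, and every Weil test g with tsupport g ⊆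
[−a,a]: 0 ≤ Re Σ'ₙ [k̂(ρₙ) + k̂(conj ρₙ)], k̂ = weilMellin (weilConv g (weilReflect g)) (= ĝ(s)·conj
ĝ(1−s̄); for ρ = 1/2+y+ix this is Φ(x−iy)·conj Φ(x+iy), Φ(z) = ∫ g e^{izt}, and ∫ Re k̂ dx = 2π‖g‖²
for every y). Conjugate (lower half-plane) points are added inside the sum; the ρ ↦ 1−ρ̄ symmetry is
deliberately NOT imposed (it only pairs equal values of Re k̂). Junk-safe: for admissible ρ the
series converges absolutely (N(T) ≪ T log T, |k̂(s)| ≪_g (1+|Im s|)⁻⁴ on the strip), and a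
refutation must exhibit actual summability with a negative sum. MEANING: with everything the tree
PROVES about N(T) plus the Platt–Trudgian height, some admissible configuration makes the Weil sum
negative on a test su -/
@[route_item "route-RiemannHypothesis-WeilAdversary", crux]
def CountingNoGo : Prop :=
  ¬ (∀ ρ : ℕ → ℂ, (∀ n, 0 < (ρ n).re ∧ (ρ n).re < 1 ∧ 0 < (ρ n).im) → (∀ n, (ρ n).im ≤ 3000175332800 → (ρ n).re = 1 / 2) → (∀ T : ℝ, {n | (ρ n).im ≤ T}.Finite) → (∀ T : ℝ, 3000175332800 ≤ T → |({n | (ρ n).im ≤ T}.ncard : ℝ) - T / (2 * Real.pi) * Real.log (T / (2 * Real.pi * Real.exp 1))| ≤ 0.3083 * Real.log T + 0 * Real.log (Real.log T) + 4.128) → ∀ g : ℝ → ℂ, Literature.NumberTheory.LFunctions.IsWeilTest g → tsupport g ⊆ Set.Icc (-(2 / 5 : ℝ)) (2 / 5) → 0 ≤ (∑' n, (Literature.NumberTheory.LFunctions.weilMellin (Literature.NumberTheory.LFunctions.weilConv g (Literature.NumberTheory.LFunctions.weilReflect g)) (ρ n) + Literature.NumberTheory.LFunctions.weilMellin (Literature.NumberTheory.LFunctions.weilConv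 g (Literature.NumberTheory.LFunctions.weilReflect g)) (starRingEnd ℂ (ρ n)))).re)

-- earlier AdversaryTransfer (stmt-RiemannHypothesis-1165, replaced 2026-08-15T16:55:38Z -> stmt-RiemannHypothesis-11224): retired by None — ∀ a T₀ c₁ c₂ c₀ : ℝ, Literature.NumberTheory.DiophantineGeometry.RiemannHypothesisUpTo T₀ → (∀ T : ℝ, T₀ ≤ T → |(Literature.NumberTheory.LFunctions.zetaZeroCount T : ℝ) - T / (2 * Real.pi) * Real.log (T / (2 * Real.pi * Real.exp 1))| ≤ c₁ * Real.log T + c₂ * Rea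
/-- item stmt-RiemannHypothesis-11224 · support · rank 9 · closed · proved by Summit.RiemannHypothesis.RiemannHypothesis.Theorems.AdversaryTransfer_proof (prover) · by planner
sources: Literature.NumberTheory.LFunctions.explicit_formula_holds, Literature.NumberTheory.LFunctions.hasWeilZeroSide_tsum, Literature.NumberTheory.LFunctions.weilZeroSummable, Literature.NumberTheory.DiophantineGeometry.RiemannHypothesisUpTo (inlined, Iff.rfl), Literature.NumberTheory.LFunctions.AdversarialWeilPositivity (landed def; Iff.rfl instance), Literature.NumberTheory.LFunctions.abs_zetaZeroCount_sub_main_le_explicit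
TRANSFER (support, provable now). RESTATED 2026-08-15 (route-repair rbadge g2): the hypothesis
`RiemannHypothesisUpTo T₀` is now INLINED as `∀ s, riemannZeta s = 0 → 0 < s.im → s.im ≤ T₀ → s.re =
1/2` — `Iff.rfl` with `Literature.NumberTheory.DiophantineGeometry.RiemannHypothesisUpTo T₀`
(checked) — so the route file no longer imports NamedHypotheses.lean and its undischarged XL fact
`riemannHypothesisUpTo_platt_trudgian`; a prover feeds that fact (or any verified height) in the
Theorems file, where it unfolds by `Iff.rfl`. STATEMENT: for all a, T₀, c₁, c₂, c₀: (RH verified up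
to height T₀) → (the true count zetaZeroCount obeys the band c₁ log T + c₂ log log T + c₀ above T₀)
→ AdvPos(a; T₀; c₁,c₂,c₀) → WeilPositivityOn a. The AdvPos block is verbatim
`Literature.NumberTheory.LFunctions.AdversarialWeilPositivity a T₀ c₁ c₂ c₀`
(AdversarialWeilPositivity.lean, landed; `Iff.rfl`; API there: adversarialWeilPositivity_iff, .anti,
.of_band_le, .anti_consts, IsWeilAdversary.summable_norm_weilAdversaryTerm /
.re_tsum_weilAdversaryTerm). PROOF SKETCH (refuter- and grounder-checked on the predecessor
stmt-RiemannHypothesis-1165, same mathematics): enumerate the non-trivial zeros with Im ρ > -/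
@[route_item "route-RiemannHypothesis-WeilAdversary", crux]
def AdversaryTransfer : Prop :=
  ∀ a T₀ c₁ c₂ c₀ : ℝ, (∀ s : ℂ, riemannZeta s = 0 → 0 < s.im → s.im ≤ T₀ → s.re = 1 / 2) → (∀ T : ℝ, T₀ ≤ T → |(Literature.NumberTheory.LFunctions.zetaZeroCount T : ℝ) - T / (2 * Real.pi) * Real.log (T / (2 * Real.pi * Real.exp 1))| ≤ c₁ * Real.log T + c₂ * Real.log (Real.log T) + c₀) → (∀ ρ : ℕ → ℂ, (∀ n, 0 < (ρ n).re ∧ (ρ n).re < 1 ∧ 0 < (ρ n).im) → (∀ n, (ρ n).im ≤ T₀ → (ρ n).re = 1 / 2) → (∀ T : ℝ, {n | (ρ n).im ≤ T}.Finite) → (∀ T : ℝ, T₀ ≤ T → |({n | (ρ n).im ≤ T}.ncard : ℝ) - T / (2 * Real.pi) * Real.log (T / (2 * Real.pi * Real.exp 1))| ≤ c₁ * Real.log T + c₂ * Real.log (Real.log T) + c₀) → ∀ g : ℝ → ℂ, Literature.NumberTheory.LFunctions.IsWeilTest g → tsupport g ⊆ Set.Icc (-a) a → 0 ≤ (∑'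 n, (Literature.NumberTheory.LFunctions.weilMellin (Literature.NumberTheory.LFunctions.weilConv g (Literature.NumberTheory.LFunctions.weilReflect g)) (ρ n) + Literature.NumberTheory.LFunctions.weilMellin (Literature.NumberTheory.LFunctions.weilConv g (Literature.NumberTheory.LFunctions.weilReflect g)) (starRingEnd ℂ (ρ n)))).re) → Literature.NumberTheory.LFunctions.WeilPositivityOn a

-- `AdversaryTransfer` holds: proved by `Summit.RiemannHypothesis.RiemannHypothesis.Theorems.AdversaryTransfer_proof` (its module imports this route file, so no `_holds` link can be stated here).

-- earlier Assembly (stmt-RiemannHypothesis-1166, replaced 2026-08-15T10:53:56Z -> stmt-RiemannHypothesis-0099): retired by None — Literature.NumberTheory.LFunctions.WeilPositivity → Summit.RiemannHypothesis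
/-- item stmt-RiemannHypothesis-0099 · assembly · rank 1 · closed · proved by Summit.RiemannHypothesis.RiemannHypothesis.Theorems.weilCombAssembly_proof @ 3105e4d941a0 (prover) · by planner
sources: Literature.NumberTheory.LFunctions.riemannHypothesis_iff_forall_weilPositivityOn, Literature.NumberTheory.LFunctions.weil_criterion_holds, Bombieri2000 Thm 2, Yoshida1992
Weil's criterion, direction positivity ⇒ RH [Weil1952; Bombieri2000 Thm 1; IwaniecKowalski2004 §5].
Expected to be discharged with the named fact weil_criterion (cite request filed) as hypothesis: (h
: weil_criterion) → this. Proof idea in print: if ρ₀ off the line, build g with ĝ concentrated at ρ₀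
and 1-ρ̄₀ making the zero side of the explicit formula for g⋆g̃ negative. -/
@[route_item "route-RiemannHypothesis-WeilAdversary", crux]
def Assembly : Prop :=
  (∀ a : ℝ, 0 < a → Literature.NumberTheory.LFunctions.WeilPositivityOn a) → Summit.RiemannHypothesis

/-- `Assembly` holds: proved by `Summit.RiemannHypothesis.RiemannHypothesis.Theorems.weilCombAssembly_proof` @ 3105e4d941a0. -/
theorem Assembly_holds : Assembly := _root_.Summit.RiemannHypothesis.RiemannHypothesis.Theorems.weilCombAssembly_proof

/-! D-0027 §2.1 — DECIDING THEOREM (planner-authored via `route open/edit --closes-file`; by planner-rbadge-RiemannHypothesis-WeilAdversary-e27d1058-g2-0 2026-08-15T16:55:38Z):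
its hypotheses are this route's items and its conclusion the sub-problem Statement (glue_lint), and it elaborates with this file. -/

@[closes "route-RiemannHypothesis-WeilAdversary"] theorem closes : AdversaryThesis → SamplingRungTwo → SamplingEngine → CountingNoGo → AdversaryTransfer → Assembly → _root_.Summit.RiemannHypothesis :=
  fun h_AdversaryThesis _h_SamplingRungTwo _h_SamplingEngine _h_CountingNoGo _h_AdversaryTransfer h_Assembly =>
    h_Assembly h_AdversaryThesis

end Summit.RiemannHypothesis.RiemannHypothesis.Theses.WeilAdversary
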